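import Summits.HodgeConjecture.HodgeConjecture.Theorems.F0P3cStCharTSDGFieldReg       -- ★ p851444 (F0P3a-p03 g23) «DG-REG★»: `isUnit_charpoly_discr_iff_isRegularElt` (brings ★ DG-FIELD p851395: the closed form, `continuous_dgFormula`, §0 units of `Π_w L_w`)
import Summits.HodgeConjecture.HodgeConjecture.Theorems.F0P3cStCharTSDGFieldTwo       -- ★ p851405 (this seat) the `N = 2` twin (`continuous_dgFormulaTwo`, `exists_unit_rel_iff_isUnit_discr_two`)
import Literature.NumberTheory.Automorphic.LocalFieldHaarBalls                          -- ★ `LocalFieldHaar.normAbs_add_eq_of_lt`, `continuous_normAbs` (`|·|_w` is locally constant off `0`)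
import HarnessLib

/-!
# F0 · P3c · line LH6 «StCharTS» — «DG-LC★» (datum road, D5 rider; brick (ε) of S13b «UPR-LC»): the Weyl discriminants `D_G` (and `D_H = D_{U(2)} ∘ pr₁`) are LOCALLY CONSTANT
# at the regular points — `|·|_w` takes discrete values off `0` [Rogawski1990, §4.9 p. 54; §12.5 pp. 182–183] [CasselsFrohlichANT1967, Ch. II §7]

Cell `pub/hodgecm-mathlib`, crux H413 = `stmt-HodgeConjecture-24833` (lane `--supports … --as helper`), route HCCMUnconditional; seat F0P3-p02 (g20); datum road of the (S-𝔇)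
organ `stub_EllipticPackage` (`Cruxes/H413/Lines/F0_P3c_StCharTSPaydown.lean`), map owner LH6-p01 (g4); brick (ε) of slice S13b «UPR-LC» (local constancy of `χ_ρ^G` at regular
points — its `D_G(x)⁻¹` factor), reusable by every local-constancy argument on the regular set.  THEOREMS ONLY (no definition ∕ instance ∕ notation ∕ named fact ∕ `sorry`); ★-only imports.
HONEST LABEL: HC_CM is proved only modulo the 7 printed citations (2 remaining named inputs: hLiu418 = `stmt-HodgeConjecture-24832`, h413 = `stmt-HodgeConjecture-24833`)
until rung 0 closes; this file closes no organ, count-neutral.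

THE MATHEMATICS.  The normalised absolute value of a non-archimedean local field is locally constant off `0`: `|a + t| = |a|` when `|t| < |a|` (★ `normAbs_add_eq_of_lt`).  The closed
form `dg(g) = √√(N(discr(charpoly g))·N(det g)⁻²)` (★ DG-FIELD; `N(x) = Π_w |x_w|_w`) is built from the continuous maps `g ↦ discr(charpoly g)_w`, `g ↦ det(g)_w` (★ `continuous_charpoly_coeff`,
`Continuous.matrix_det`), which do not vanish at a REGULAR `g` (★ DG-REG `isUnit_charpoly_discr_iff_isRegularElt`; `det g` is a unit); hence every factor `|·|_w` is eventually
constant near `g`, and so is `dg`.  At a datum with the D5 field equation `hDG : 𝔇.DG = dg` this is «`D_G` locally constant on `G^r`»; the `N = 2` twin gives «`D_H = DG₂ ∘ pr₁` locally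
constant at the `G`-regular points of `H_v`» (pin (P6) of ★ H-FIELDS).
* §1 `eventually_normAbs_comp_eq` — `f` continuous at `x` into `L_w` with `f x ≠ 0` ⇒ `|f ·|_w` eventually equals `|f x|_w`; `eventually_prod_normAbs_apply_eq` — the same for
  `y ↦ Π_w |(F y)_w|_w`, `F` continuous at `x` into `R = Π_w L_w` with `F x` a unit;
* §2 `dgFormula_eventually_eq` (regular `g ∈ U(Φ₃)(L⁺_v)`), `DG_eventually_eq_of_isRegularElt` (at a datum with `hDG`), `DG_eventually_eq_of_mem_regG` (through COMPAT `hreg`);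
* §3 the `N = 2` twin `dgFormulaTwo_eventually_eq` (at `γ` with unit discriminant) and `DGtwo_fst_eventually_eq` («`D_H = DG₂ ∘ pr₁` locally constant at points of `U(J)(L⁺_v) × G₁` whose
  first component has unit discriminant», any field equation `hDH : ∀ h, DH h = dg₂ h.1`).

## References
* [Rogawski1990] J. D. Rogawski, *Automorphic Representations of Unitary Groups in Three Variables*, Ann. of Math. Stud. 123 (1990): §4.9 p. 54 (`D_G`, `D_H`); §12.5 pp. 182–183
  (Lemma 12.5.1: `D_G(γ)α^G(γ^δ)` locally constant on `T^r`).
* [CasselsFrohlichANT1967] J. W. S. Cassels, A. Fröhlich (eds.), *Algebraic Number Theory* (1967), Ch. II §7 (the normalised absolute value; `|a + t| = |a|` for `|t| < |a|`).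
-/

set_option autoImplicit false
-- the mandated namespace has the single-problem summit's repeated segment (`HodgeConjecture.HodgeConjecture`)
set_option linter.dupNamespace false

noncomputable section

open MeasureTheory Filter Topology Polynomial
open NumberField IsDedekindDomain
open scoped NNReal Matrix MatrixGroups
open Literature.NumberTheory.Automorphic Literature.NumberTheory.Automorphic.UnitaryGroup
open Literature.NumberTheory.GaloisRepresentations Literature.NumberTheory.GaloisRepresentations.IsNonarchimedeanLocalField
open Literature.NumberTheory.Rogawski1990 Literature.NumberTheory.Rogawski1990.Ch12Sec5

namespace Summit.HodgeConjecture.HodgeConjecture.Cruxes.H413.F0P3cStCharTSDGLc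

open Summit.HodgeConjecture.HodgeConjecture.Cruxes.H413.F0P3cStCharTSDGField

variable (L : Type) [Field L] [NumberField L] [IsCMField L] (v : HeightOneSpectrum (𝓞 ↥(maximalRealSubfield L)))

/-! ## §1 `|·|_w` is locally constant off `0`; products over the places `w ∣ v` -/

omit [IsCMField L] in
/-- **`|f(y)|_w = |f(x)|_w` near `x`** for `f` continuous at `x` into `L_w` with `f x ≠ 0` (`|a + t|_w = |a|_w` for `|t|_w < |a|_w`, ★ `normAbs_add_eq_of_lt`; `|f(y) − f(x)|_w → 0`).
[cite: CasselsFrohlichANT1967, Ch. II §7] -/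
theorem eventually_normAbs_comp_eq {X : Type*} [TopologicalSpace X] (w : PlacesOver L v) {f : X → w.1.adicCompletion L} {x : X}
    (hf : ContinuousAt f x) (hx : f x ≠ 0) :
    ∀ᶠ y in 𝓝 x, normAbs (w.1.adicCompletion L) (f y) = normAbs (w.1.adicCompletion L) (f x) := by
  have h0 : (0 : ℝ≥0) < normAbs (w.1.adicCompletion L) (f x) := pos_iff_ne_zero.2 ((_root_.map_ne_zero _).2 hx)
  have hc : ContinuousAt (fun y => normAbs (w.1.adicCompletion L) (f y - f x)) x :=
    LocalFieldHaar.continuous_normAbs.continuousAt.comp (hf.sub continuousAt_const)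
  have hlt : ∀ᶠ y in 𝓝 x, normAbs (w.1.adicCompletion L) (f y - f x) < normAbs (w.1.adicCompletion L) (f x) := by
    have h1 : (fun y => normAbs (w.1.adicCompletion L) (f y - f x)) x < normAbs (w.1.adicCompletion L) (f x) := by
      simp only [sub_self, map_zero]; exact h0
    exact hc.eventually (gt_mem_nhds h1)
  filter_upwards [hlt] with y hy
  have := LocalFieldHaar.normAbs_add_eq_of_lt hy
  rwa [add_sub_cancel] at this

omit [IsCMField L] in
/-- **`Π_w |F(y)_w|_w = Π_w |F(x)_w|_w` near `x`** for `F` continuous at `x` into `R = Π_w L_w` with `F x` a UNIT (every component non-zero, ★ DG-FIELD §0).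
[cite: CasselsFrohlichANT1967, Ch. II §7] -/
theorem eventually_prod_normAbs_apply_eq {X : Type*} [TopologicalSpace X] {F : X → UnitaryGroup.LocalRing L v} {x : X} (hF : ContinuousAt F x) (hx : IsUnit (F x)) :
    ∀ᶠ y in 𝓝 x, (∏ w : PlacesOver L v, normAbs (w.1.adicCompletion L) (F y w)) = ∏ w : PlacesOver L v, normAbs (w.1.adicCompletion L) (F x w) := by
  have h : ∀ w : PlacesOver L v, ∀ᶠ y in 𝓝 x, normAbs (w.1.adicCompletion L) (F y w) = normAbs (w.1.adicCompletion L) (F x w) := fun w =>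
    eventually_normAbs_comp_eq L v w ((continuous_apply w).continuousAt.comp hF) (apply_ne_zero_of_isUnit L v hx w)
  filter_upwards [Filter.eventually_all.2 h] with y hy
  exact Finset.prod_congr rfl fun w _ => hy w

/-! ## §2 `N = 3`: the closed form `dg` and the datum field `𝔇.DG` are locally constant at the regular points of `U(Φ₃)(L⁺_v)` -/

/-- **The closed form is locally constant at a regular `g`** (`discr(charpoly g)` is a unit there, ★ DG-REG; `det g` is a unit; §1 factorwise). [cite: Rogawski1990, §4.9 p. 54; §12.5 p. 183] -/
theorem dgFormula_eventually_eq (g : Gqs L v) (hg : IsRegularElt (g.val : GL (Fin 3) (UnitaryGroup.LocalRing L v))) :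
    ∀ᶠ y in 𝓝 g,
      ((NNReal.sqrt (NNReal.sqrt
        ((∏ w : PlacesOver L v, normAbs (w.1.adicCompletion L) (((y.val : GL (Fin 3) (UnitaryGroup.LocalRing L v)).val.charpoly.discr) w)) *
          ((∏ w : PlacesOver L v, normAbs (w.1.adicCompletion L) (((y.val : GL (Fin 3) (UnitaryGroup.LocalRing L v)).val.det) w)) ^ 2)⁻¹)) : ℝ≥0) : ℝ) =
      ((NNReal.sqrt (NNReal.sqrt
        ((∏ w : PlacesOver L v, normAbs (w.1.adicCompletion L) (((g.val : GL (Fin 3) (UnitaryGroup.LocalRing L v)).val.charpoly.discr) w)) *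
          ((∏ w : PlacesOver L v, normAbs (w.1.adicCompletion L) (((g.val : GL (Fin 3) (UnitaryGroup.LocalRing L v)).val.det) w)) ^ 2)⁻¹)) : ℝ≥0) : ℝ) := by
  have hM : Continuous fun y : Gqs L v => ((y.val : GL (Fin 3) (UnitaryGroup.LocalRing L v)).val : Matrix (Fin 3) (Fin 3) (UnitaryGroup.LocalRing L v)) :=
    Units.continuous_val.comp continuous_subtype_val
  -- `discr (charpoly y)` is continuous (polynomial in the coefficients, degree 3) and a unit at `g`
  have hdisc : Continuous fun y : Gqs L v => (y.val : GL (Fin 3) (UnitaryGroup.LocalRing L v)).val.charpoly.discr := by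
    have heq : (fun y : Gqs L v => (y.val : GL (Fin 3) (UnitaryGroup.LocalRing L v)).val.charpoly.discr) = fun y : Gqs L v =>
        (y.val : GL (Fin 3) (UnitaryGroup.LocalRing L v)).val.charpoly.coeff 2 ^ 2 * (y.val : GL (Fin 3) (UnitaryGroup.LocalRing L v)).val.charpoly.coeff 1 ^ 2
          - 4 * (y.val : GL (Fin 3) (UnitaryGroup.LocalRing L v)).val.charpoly.coeff 3 * (y.val : GL (Fin 3) (UnitaryGroup.LocalRing L v)).val.charpoly.coeff 1 ^ 3
          - 4 * (y.val : GL (Fin 3) (UnitaryGroup.LocalRing L v)).val.charpoly.coeff 2 ^ 3 * (y.val : GL (Fin 3) (UnitaryGroup.LocalRing L v)).val.charpoly.coeff 0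
          - 27 * (y.val : GL (Fin 3) (UnitaryGroup.LocalRing L v)).val.charpoly.coeff 3 ^ 2 * (y.val : GL (Fin 3) (UnitaryGroup.LocalRing L v)).val.charpoly.coeff 0 ^ 2
          + 18 * (y.val : GL (Fin 3) (UnitaryGroup.LocalRing L v)).val.charpoly.coeff 3 * (y.val : GL (Fin 3) (UnitaryGroup.LocalRing L v)).val.charpoly.coeff 2 *
              (y.val : GL (Fin 3) (UnitaryGroup.LocalRing L v)).val.charpoly.coeff 1 * (y.val : GL (Fin 3) (UnitaryGroup.LocalRing L v)).val.charpoly.coeff 0 := by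
      funext y
      exact discr_of_degree_eq_three (by rw [Matrix.charpoly_degree_eq_dim]; rfl)
    have hc : ∀ i : ℕ, Continuous fun y : Gqs L v => ((y.val : GL (Fin 3) (UnitaryGroup.LocalRing L v)).val.charpoly.coeff i) :=
      fun i => (Literature.LinearAlgebra.Matrix.continuous_charpoly_coeff i).comp hM
    rw [heq]
    fun_prop
  have hdet : Continuous fun y : Gqs L v => (y.val : GL (Fin 3) (UnitaryGroup.LocalRing L v)).val.det := (continuous_id.matrix_det).comp hM
  have h1 := eventually_prod_normAbs_apply_eq L v hdisc.continuousAt ((F0P3cStCharTSDGFieldReg.isUnit_charpoly_discr_iff_isRegularElt L v g).2 hg)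
  have h2 := eventually_prod_normAbs_apply_eq L v hdet.continuousAt (Matrix.isUnits_det_units (g.val : GL (Fin 3) (UnitaryGroup.LocalRing L v)))
  filter_upwards [h1, h2] with y hy1 hy2
  rw [hy1, hy2]

/-- **`𝔇.DG` is locally constant at the regular points** under the D5 field equation (★ DG-FIELD's `hDG` text). [cite: Rogawski1990, §4.9 p. 54; §12.5 p. 183] -/
theorem DG_eventually_eq_of_isRegularElt
    [MeasurableSpace (Gqs L v)]
    [∀ γ : Gqs L v, MeasurableSpace (Gqs L v ⧸ Subgroup.centralizer ({γ} : Set (Gqs L v)))] [MeasurableSpace (Gqs L v ⧸ Subgroup.center (Gqs L v))]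
    {H : Type} [Group H] [TopologicalSpace H] [IsTopologicalGroup H] [MeasurableSpace H]
    (𝔇 : EllipticData (Gqs L v) H)
    (hDG : ∀ g : Gqs L v, 𝔇.DG g =
      ((NNReal.sqrt (NNReal.sqrt
        ((∏ w : PlacesOver L v, normAbs (w.1.adicCompletion L) (((g.val : GL (Fin 3) (UnitaryGroup.LocalRing L v)).val.charpoly.discr) w)) *
          ((∏ w : PlacesOver L v, normAbs (w.1.adicCompletion L) (((g.val : GL (Fin 3) (UnitaryGroup.LocalRing L v)).val.det) w)) ^ 2)⁻¹)) : ℝ≥0) : ℝ))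
    (x : Gqs L v) (hx : IsRegularElt (x.val : GL (Fin 3) (UnitaryGroup.LocalRing L v))) :
    ∀ᶠ y in 𝓝 x, 𝔇.DG y = 𝔇.DG x := by
  filter_upwards [dgFormula_eventually_eq L v x hx] with y hy
  rw [hDG y, hDG x, hy]

/-- The same read through COMPAT `hreg` (`x ∈ 𝔇.regG`) — the shape S13b consumes. [cite: Rogawski1990, §12.5 p. 183] -/
theorem DG_eventually_eq_of_mem_regG
    [MeasurableSpace (Gqs L v)]
    [∀ γ : Gqs L v, MeasurableSpace (Gqs L v ⧸ Subgroup.centralizer ({γ} : Set (Gqs L v)))] [MeasurableSpace (Gqs L v ⧸ Subgroup.center (Gqs L v))]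
    {H : Type} [Group H] [TopologicalSpace H] [IsTopologicalGroup H] [MeasurableSpace H]
    (𝔇 : EllipticData (Gqs L v) H)
    (hreg : ∀ γ : Gqs L v, γ ∈ 𝔇.regG ↔ IsRegularElt (γ.val : GL (Fin 3) (UnitaryGroup.LocalRing L v)))
    (hDG : ∀ g : Gqs L v, 𝔇.DG g =
      ((NNReal.sqrt (NNReal.sqrt
        ((∏ w : PlacesOver L v, normAbs (w.1.adicCompletion L) (((g.val : GL (Fin 3) (UnitaryGroup.LocalRing L v)).val.charpoly.discr) w)) *
          ((∏ w : PlacesOver L v, normAbs (w.1.adicCompletion L) (((g.val : GL (Fin 3) (UnitaryGroup.LocalRing L v)).val.det) w)) ^ 2)⁻¹)) : ℝ≥0) : ℝ)) :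
    ∀ x ∈ 𝔇.regG, ∀ᶠ y in 𝓝 x, 𝔇.DG y = 𝔇.DG x :=
  fun x hx => DG_eventually_eq_of_isRegularElt L v 𝔇 hDG x ((hreg x).1 hx)

/-! ## §3 `N = 2`: the closed form `dg₂` is locally constant at the points of unit discriminant; `D_H = dg₂ ∘ pr₁` at the `G`-regular points of `U(J)(L⁺_v) × G₁` -/

section Two

variable (J : Matrix (Fin 2) (Fin 2) L)

/-- **The `N = 2` closed form is locally constant at a `γ` with unit discriminant.** [cite: Rogawski1990, §4.9 pp. 54–55] -/
theorem dgFormulaTwo_eventually_eq (g : (UnitaryGroup.cmDatum L 2 J).Local v) (hg : IsUnit ((g.val : GL (Fin 2) (UnitaryGroup.LocalRing L v)).val.charpoly.discr)) :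
    ∀ᶠ y in 𝓝 g,
      ((NNReal.sqrt (NNReal.sqrt
        ((∏ w : PlacesOver L v, normAbs (w.1.adicCompletion L) (((y.val : GL (Fin 2) (UnitaryGroup.LocalRing L v)).val.charpoly.discr) w)) *
          (∏ w : PlacesOver L v, normAbs (w.1.adicCompletion L) (((y.val : GL (Fin 2) (UnitaryGroup.LocalRing L v)).val.det) w))⁻¹)) : ℝ≥0) : ℝ) =
      ((NNReal.sqrt (NNReal.sqrt
        ((∏ w : PlacesOver L v, normAbs (w.1.adicCompletion L) (((g.val : GL (Fin 2) (UnitaryGroup.LocalRing L v)).val.charpoly.discr) w)) *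
          (∏ w : PlacesOver L v, normAbs (w.1.adicCompletion L) (((g.val : GL (Fin 2) (UnitaryGroup.LocalRing L v)).val.det) w))⁻¹)) : ℝ≥0) : ℝ) := by
  have hM : Continuous fun y : (UnitaryGroup.cmDatum L 2 J).Local v => ((y.val : GL (Fin 2) (UnitaryGroup.LocalRing L v)).val : Matrix (Fin 2) (Fin 2) (UnitaryGroup.LocalRing L v)) :=
    Units.continuous_val.comp continuous_subtype_val
  have hdisc : Continuous fun y : (UnitaryGroup.cmDatum L 2 J).Local v => (y.val : GL (Fin 2) (UnitaryGroup.LocalRing L v)).val.charpoly.discr := by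
    have heq : (fun y : (UnitaryGroup.cmDatum L 2 J).Local v => (y.val : GL (Fin 2) (UnitaryGroup.LocalRing L v)).val.charpoly.discr) = fun y : (UnitaryGroup.cmDatum L 2 J).Local v =>
        (y.val : GL (Fin 2) (UnitaryGroup.LocalRing L v)).val.charpoly.coeff 1 ^ 2 - 4 * (y.val : GL (Fin 2) (UnitaryGroup.LocalRing L v)).val.charpoly.coeff 0 * (y.val : GL (Fin 2) (UnitaryGroup.LocalRing L v)).val.charpoly.coeff 2 := by
      funext y
      exact discr_of_degree_eq_two (by rw [Matrix.charpoly_degree_eq_dim]; rfl)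
    have hc : ∀ i : ℕ, Continuous fun y : (UnitaryGroup.cmDatum L 2 J).Local v => ((y.val : GL (Fin 2) (UnitaryGroup.LocalRing L v)).val.charpoly.coeff i) :=
      fun i => (Literature.LinearAlgebra.Matrix.continuous_charpoly_coeff i).comp hM
    rw [heq]
    fun_prop
  have hdet : Continuous fun y : (UnitaryGroup.cmDatum L 2 J).Local v => (y.val : GL (Fin 2) (UnitaryGroup.LocalRing L v)).val.det := (continuous_id.matrix_det).comp hM
  have h1 := eventually_prod_normAbs_apply_eq L v hdisc.continuousAt hg
  have h2 := eventually_prod_normAbs_apply_eq L v hdet.continuousAt (Matrix.isUnits_det_units (g.val : GL (Fin 2) (UnitaryGroup.LocalRing L v)))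
  filter_upwards [h1, h2] with y hy1 hy2
  rw [hy1, hy2]

/-- **«DH-lc»: `D_H = dg₂ ∘ pr₁` is locally constant at every point of `U(J)(L⁺_v) × G₁` whose first component has unit discriminant** (e.g. every `G`-regular point of
`H_v`, ★ `F0P3cStCharTSHFields.isRegularElt_fst_of_isLocalGRegular` + ★ DG-REG's `N = 2` reading) — for ANY function `DH` with the field equation `hDH : DH h = dg₂ h.1`
(pin (P6) of ★ H-FIELDS at the ★ `exists_DG_field_two` witness).  The hypothesis `hDHlc` of S13b (δ). [cite: Rogawski1990, §4.9 pp. 54–55; §12.5 p. 183] -/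
theorem DGtwo_fst_eventually_eq {G₁ : Type} [TopologicalSpace G₁]
    (DH : (UnitaryGroup.cmDatum L 2 J).Local v × G₁ → ℝ)
    (hDH : ∀ h : (UnitaryGroup.cmDatum L 2 J).Local v × G₁, DH h =
      ((NNReal.sqrt (NNReal.sqrt
        ((∏ w : PlacesOver L v, normAbs (w.1.adicCompletion L) (((h.1.val : GL (Fin 2) (UnitaryGroup.LocalRing L v)).val.charpoly.discr) w)) *
          (∏ w : PlacesOver L v, normAbs (w.1.adicCompletion L) (((h.1.val : GL (Fin 2) (UnitaryGroup.LocalRing L v)).val.det) w))⁻¹)) : ℝ≥0) : ℝ))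
    (s : (UnitaryGroup.cmDatum L 2 J).Local v × G₁) (hs : IsUnit ((s.1.val : GL (Fin 2) (UnitaryGroup.LocalRing L v)).val.charpoly.discr)) :
    ∀ᶠ s' in 𝓝 s, DH s' = DH s := by
  have h := (dgFormulaTwo_eventually_eq L v J s.1 hs)
  have h' := continuous_fst.continuousAt.eventually h
  filter_upwards [h'] with s' hs'
  rw [hDH s', hDH s]
  exact hs'

end Two

end Summit.HodgeConjecture.HodgeConjecture.Cruxes.H413.F0P3cStCharTSDGLc

end
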